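import Literature.Probability.RandomMatrix.LovasAndaiLemma6
import Literature.Analysis.SpecialFunctions.TanhPartialFractions

/-!
# Lovas–Andai 2017, Theorem 2 (`𝒫_sep(ℝ) = 29/64`) — the final integral, part I: kernel and value

A. Lovas, A. Andai, *Invariance of separability probability over reduced states in 4 × 4 bipartite
systems*, J. Phys. A 50 (2017) 295303 [LovasAndai2017] (held: arXiv:1610.01410), proof of
Theorem 2 (p. 8 of the arXiv version): after Corollary 2 and Lemma 6 the two-rebit separability
probability is the ratio

  `𝒫 = ∫∫_{-1<y<x<1} χ̃₁(ε(x,y)) (1−x²)(1−y²)(x−y) dy dx / ∫∫_{-1<y<x<1} (1−x²)(1−y²)(x−y) dy dx`,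
  `ε(x,y) = √((1−x)(1+y)/((1+x)(1−y)))`, `χ̃₁(e) = (4/π²)∫₀^e k`,
  `k(s) = (s + 1/s − ½(s − 1/s)² log((1+s)/(1−s)))/s`  (Lemma 6),

and the paper evaluates it to `(16/35 − 1/4)/(16/35) = 29/64` by the substitutions
`u = (1−x)/(1+x)`, `v = (1−y)/(1+y)`, `u = ts`, `v = s/t`, an integration by parts and a
dilogarithmic primitive ("one can check that …").

## This file: an elementary evaluation of the same integral (no polylogarithms)

We reorganise the printed computation as follows (this is the content of the two files
`LovasAndaiTheorem2Kernel` (here) and `LovasAndaiTheorem2Integral` (the change of variables)).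
Write `x = tanh α`, `y = tanh β`, `γ = α − β > 0`, so that `ε = e^{−γ}` and
`(1−x²)(1−y²)(x−y) dx dy = sinh(α−β) sech⁵α sech⁵β dα dβ`; integrating out `β` at fixed `γ`
(`sech(β+γ) sech β = 2/(cosh(2β+γ) + cosh γ)`) turns the weight into the density
`dens(γ) = 4 sinh γ · Y₅(γ)` on `(0, ∞)`, where

  `Y_n(γ) = ∫_ℝ dθ / (cosh θ + cosh γ)ⁿ`   (`Y`, `Yc`),   `Y₄' = −dens`   (`hasDerivAt_Y4`).

* **Kernel identities** (pointwise calculus only). The `θ`-primitive `sinh θ/(cosh θ + c)⁵` gives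
  the three-term relation `4Y₄ − 9cY₅ + 5(c²−1)Y₆ = 0` (`Yc_three_term`); differentiation under
  the integral sign gives `dY_n/dc = −n Y_{n+1}` (`hasDerivAt_Yc`); together they yield the
  certificate `P̄_m' = ((m+4)² e^{−mγ} − (m−2)² e^{−(m+2)γ}) Y₄` (`hasDerivAt_Pbar`) and, integrating
  over `(0, ∞)`, the **Laplace recursion** `(m+4)² L(m) − (m−2)² L(m+2) = 14 Y₄(0)`,
  `L(m) = ∫₀^∞ e^{−mγ} Y₄(γ) dγ` (`laplace_recursion`), and `∫₀^∞ e^{−mγ} dens = Y₄(0) − m L(m)`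
  (`integral_exp_mul_dens`), `∫₀^∞ dens = Y₄(0)` (`integral_dens`).
* **Series.** `k(t) = Σ_j κ_j t^{2j}`, `κ_j = −8/((2j−1)(2j+1)(2j+3))` (`hasSum_kap_mul_pow`, from
  `artanh`), hence `∫₀^e k = Σ κ_j e^{2j+1}/(2j+1)` (`hasSum_Kfun`, dominated convergence).
* **Summation.** With `a_j = L(2j+1)` the recursion reads `(2j+5)² a_j − (2j−1)² a_{j+1} = 14Y₄(0)`;
  Abel summation with the weights `w_j = (D_j − 9)/(8D_j²)`, `D_j = (2j−1)(2j+1)(2j+3)(2j+5)`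
  (`wA_rec`, `sum_a_div_Dt`) and the classical `Σ 1/(2l+1)² = π²/8`
  (`Literature.Analysis.SpecialFunctions.hasSum_one_div_odd_sq`) give
  `Σ_l (9 − D_l)/D_l² = 5π²/512` (`hasSum_nine_sub_Dq`) and `Σ_j κ_j a_j = 35π² Y₄(0)/256`
  (`hasSum_kap_mul_L`).
* **Value.** Exchanging sum and integral once more,
  `∫₀^∞ χ̃₁(e^{−γ}) dens(γ) dγ = (4/π²)(Y₄(0) K(1) − 35π²Y₄(0)/256) = (29/64) Y₄(0)` as soon as
  `K(1) = ∫₀¹ k = π²/4`, which is Lemma 6 at `ε = 1` (tree: `LovasAndai2017_lemma6_holds`,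
  `LovasAndaiLemma6.lovasAndaiChiOne_one`): `integral_chiTilde_mul_dens_eq`. Numerically
  `Y₄(0) = 4/35`, `L(0) = 1/9`, `L(1) = π²/64 − 4/45`, `L(2) = 2/45` (not needed and not proved).

The remark that the printed closed form of `∫₀^t F` on p. 8 lacks a factor `t⁴` (checked
numerically) is immaterial here: no closed form of that function is used.

All declarations live in the sub-namespace `Literature.Probability.RandomMatrix.LovasAndai2017`
(grouping by paper), like `TwoQubitSeparabilityVolumesRebitFullProofs.lean`.

## References

* [LovasAndai2017] A. Lovas, A. Andai, J. Phys. A 50 (2017) 295303, §2 (Lemma 6), §3 (Cor. 2,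
  Thm. 2 and its proof). arXiv:1610.01410.
-/

noncomputable section

open MeasureTheory Set Filter Topology

namespace Literature.Probability.RandomMatrix.LovasAndai2017

/-! ### Elementary bounds on `cosh` -/

/-- `(1 + θ²)/2 ≤ cosh θ + c` for `c ≥ 0` (two terms of the power series of `cosh`; the bound
`1 + x²/2 ≤ cosh x` is `Literature.Analysis.Complex.DeBruijn1950.one_add_sq_div_two_le_cosh`,
re-derived inline to keep the import graph small). [folklore] -/
theorem half_one_add_sq_le_cosh_add (θ : ℝ) {c : ℝ} (hc : 0 ≤ c) :
    (1 + θ ^ 2) / 2 ≤ Real.cosh θ + c := by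
  have hcosh : 1 + θ ^ 2 / 2 ≤ Real.cosh θ := by
    have h := Real.hasSum_cosh θ
    have hnn : ∀ n, 0 ≤ θ ^ (2 * n) / ((2 * n).factorial : ℝ) := fun n => by
      rw [pow_mul]; positivity
    have := sum_le_hasSum (Finset.range 2) (fun n _ => hnn n) h
    simpa [Finset.sum_range_succ, Nat.factorial] using this
  nlinarith [sq_nonneg θ]

/-- `0 < cosh θ + c` for `c ≥ 0`. [folklore] -/
theorem cosh_add_pos (θ : ℝ) {c : ℝ} (hc : 0 ≤ c) : 0 < Real.cosh θ + c := by
  linarith [Real.one_le_cosh θ]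

/-- `((cosh θ + c)ⁿ)⁻¹ ≤ 2 (1 + θ²)⁻¹` for `n ≥ 1`, `c ≥ 0`. [folklore] -/
theorem inv_pow_cosh_add_le (θ : ℝ) {c : ℝ} (hc : 0 ≤ c) {n : ℕ} (hn : 1 ≤ n) :
    ((Real.cosh θ + c) ^ n)⁻¹ ≤ 2 * (1 + θ ^ 2)⁻¹ := by
  have h1 : 1 ≤ Real.cosh θ + c := by linarith [Real.one_le_cosh θ]
  have hpow : Real.cosh θ + c ≤ (Real.cosh θ + c) ^ n := by
    calc Real.cosh θ + c = (Real.cosh θ + c) ^ 1 := (pow_one _).symm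
      _ ≤ (Real.cosh θ + c) ^ n := pow_le_pow_right₀ h1 hn
  have h2 := half_one_add_sq_le_cosh_add θ hc
  have hpos : 0 < 1 + θ ^ 2 := by positivity
  rw [show 2 * (1 + θ ^ 2)⁻¹ = ((1 + θ ^ 2) / 2)⁻¹ by field_simp]
  exact inv_anti₀ (by positivity) (h2.trans hpow)

/-- A power of `cosh θ + c` dominates a lower power (`c ≥ 0`). [folklore] -/
theorem inv_pow_cosh_add_le_inv_pow (θ : ℝ) {c : ℝ} (hc : 0 ≤ c) {m n : ℕ} (hmn : m ≤ n) :
    ((Real.cosh θ + c) ^ n)⁻¹ ≤ ((Real.cosh θ + c) ^ m)⁻¹ := by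
  have h1 : 1 ≤ Real.cosh θ + c := by linarith [Real.one_le_cosh θ]
  exact inv_anti₀ (by positivity) (pow_le_pow_right₀ h1 hmn)

/-- Continuity of `θ ↦ ((cosh θ + c)ⁿ)⁻¹`. [folklore] -/
theorem continuous_inv_pow_cosh_add {c : ℝ} (hc : 0 ≤ c) (n : ℕ) :
    Continuous fun θ : ℝ => ((Real.cosh θ + c) ^ n)⁻¹ := by
  refine Continuous.inv₀ ((Real.continuous_cosh.add continuous_const).pow n) fun θ => ?_
  exact pow_ne_zero _ (cosh_add_pos θ hc).ne'

/-- Integrability of `θ ↦ ((cosh θ + c)ⁿ)⁻¹` on `ℝ` for `n ≥ 1`. [folklore] -/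
theorem integrable_inv_pow_cosh_add {c : ℝ} (hc : 0 ≤ c) {n : ℕ} (hn : 1 ≤ n) :
    Integrable fun θ : ℝ => ((Real.cosh θ + c) ^ n)⁻¹ := by
  refine Integrable.mono' (integrable_inv_one_add_sq.const_mul 2)
    (continuous_inv_pow_cosh_add hc n).aestronglyMeasurable (Eventually.of_forall fun θ => ?_)
  rw [Real.norm_eq_abs, abs_of_nonneg (inv_nonneg.2 (pow_nonneg (cosh_add_pos θ hc).le _))]
  exact inv_pow_cosh_add_le θ hc hn

/-- `(cosh θ)⁻¹ → 0` as `θ → +∞`. [folklore] -/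
theorem tendsto_inv_cosh_atTop : Tendsto (fun θ : ℝ => (Real.cosh θ)⁻¹) atTop (𝓝 0) := by
  have h : ∀ θ : ℝ, (Real.cosh θ)⁻¹ ≤ 2 * Real.exp (-θ) := by
    intro θ
    have h1 : 0 < Real.exp θ := Real.exp_pos θ
    calc (Real.cosh θ)⁻¹ ≤ (Real.exp θ / 2)⁻¹ := by
          refine inv_anti₀ (by positivity) ?_
          rw [Real.cosh_eq]
          linarith [Real.exp_pos (-θ)]
      _ = 2 * Real.exp (-θ) := by rw [Real.exp_neg]; field_simp
  refine squeeze_zero (fun θ => (inv_nonneg.2 (Real.cosh_pos θ).le)) h ?_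
  simpa using (Real.tendsto_exp_neg_atTop_nhds_zero).const_mul 2

/-- `(cosh θ)⁻¹ → 0` as `θ → −∞`. [folklore] -/
theorem tendsto_inv_cosh_atBot : Tendsto (fun θ : ℝ => (Real.cosh θ)⁻¹) atBot (𝓝 0) := by
  have := tendsto_inv_cosh_atTop.comp tendsto_neg_atBot_atTop
  refine this.congr fun θ => ?_
  simp [Function.comp, Real.cosh_neg]

/-! ### The kernel `Yc n c = ∫ dθ / (cosh θ + c)ⁿ` -/

/-- `Yc n c = ∫_ℝ dθ / (cosh θ + c)ⁿ` (Lovas–Andai kernel moments; used with `c = cosh γ`).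
[cite: LovasAndai2017, Theorem 2 (proof), our reorganisation] -/
def Yc (n : ℕ) (c : ℝ) : ℝ := ∫ θ : ℝ, ((Real.cosh θ + c) ^ n)⁻¹

/-- `Yc n c ≥ 0`. [folklore] -/
theorem Yc_nonneg (n : ℕ) {c : ℝ} (hc : 0 ≤ c) : 0 ≤ Yc n c :=
  integral_nonneg fun θ => inv_nonneg.2 (pow_nonneg (cosh_add_pos θ hc).le _)

/-- Monotonicity in `c`: `Yc n c ≤ Yc n c'` for `0 ≤ c' ≤ c`. [folklore] -/
theorem Yc_anti {n : ℕ} (hn : 1 ≤ n) {c c' : ℝ} (hc' : 0 ≤ c') (hcc' : c' ≤ c) :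
    Yc n c ≤ Yc n c' := by
  refine integral_mono (integrable_inv_pow_cosh_add (hc'.trans hcc') hn)
    (integrable_inv_pow_cosh_add hc' hn) fun θ => ?_
  have h0 : 0 < Real.cosh θ + c' := cosh_add_pos θ hc'
  exact inv_anti₀ (pow_pos h0 n) (pow_le_pow_left₀ h0.le (by linarith) n)

/-- `Yc n c ≤ Yc m c` for `1 ≤ m ≤ n`, `c ≥ 0`. [folklore] -/
theorem Yc_le_of_le {m n : ℕ} (hm : 1 ≤ m) (hmn : m ≤ n) {c : ℝ} (hc : 0 ≤ c) :
    Yc n c ≤ Yc m c :=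
  integral_mono (integrable_inv_pow_cosh_add hc (hm.trans hmn))
    (integrable_inv_pow_cosh_add hc hm) fun θ => inv_pow_cosh_add_le_inv_pow θ hc hmn

/-- The **three-term relation** `4 Y₄ − 9c Y₅ + 5(c² − 1) Y₆ = 0` (`c ≥ 0`): integrate
`d/dθ [sinh θ / (cosh θ + c)⁵] = −4/(·)⁴ + 9c/(·)⁵ − 5(c² − 1)/(·)⁶` over `ℝ`.
[cite: LovasAndai2017, Theorem 2 (proof), our reorganisation] -/
theorem Yc_three_term {c : ℝ} (hc : 0 ≤ c) :
    4 * Yc 4 c - 9 * c * Yc 5 c + 5 * (c ^ 2 - 1) * Yc 6 c = 0 := by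
  set F : ℝ → ℝ := fun θ => Real.sinh θ * ((Real.cosh θ + c) ^ 5)⁻¹ with hF
  set F' : ℝ → ℝ := fun θ => -4 * ((Real.cosh θ + c) ^ 4)⁻¹ + 9 * c * ((Real.cosh θ + c) ^ 5)⁻¹
      - 5 * (c ^ 2 - 1) * ((Real.cosh θ + c) ^ 6)⁻¹ with hF'
  have hD : ∀ θ, 0 < Real.cosh θ + c := fun θ => cosh_add_pos θ hc
  have hderiv : ∀ θ, HasDerivAt F (F' θ) θ := by
    intro θ
    have hD0 : Real.cosh θ + c ≠ 0 := (hD θ).ne'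
    have h1 : HasDerivAt (fun θ => (Real.cosh θ + c) ^ 5)
        (5 * (Real.cosh θ + c) ^ 4 * Real.sinh θ) θ := by
      simpa using ((Real.hasDerivAt_cosh θ).add_const c).fun_pow 5
    have h2 := (Real.hasDerivAt_sinh θ).fun_mul (h1.fun_inv (pow_ne_zero _ hD0))
    refine h2.congr_deriv ?_
    have hsq : Real.sinh θ ^ 2 = Real.cosh θ ^ 2 - 1 := Real.sinh_sq θ
    have e1 : Real.sinh θ * (-(5 * (Real.cosh θ + c) ^ 4 * Real.sinh θ) /
        ((Real.cosh θ + c) ^ 5) ^ 2) = -5 * (Real.cosh θ ^ 2 - 1) *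
          ((Real.cosh θ + c) ^ 4 / ((Real.cosh θ + c) ^ 5) ^ 2) := by
      rw [← hsq]; ring
    rw [e1]
    simp only [hF']
    field_simp
    ring
  have hFint : Integrable F' := by
    have i4 := integrable_inv_pow_cosh_add hc (n := 4) (by norm_num)
    have i5 := integrable_inv_pow_cosh_add hc (n := 5) (by norm_num)
    have i6 := integrable_inv_pow_cosh_add hc (n := 6) (by norm_num)
    exact ((i4.const_mul (-4)).add (i5.const_mul (9 * c))).sub (i6.const_mul (5 * (c ^ 2 - 1)))
  -- `F → 0` at `±∞`: `|F θ| ≤ (cosh θ)⁻¹`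
  have hbound : ∀ θ, |F θ| ≤ (Real.cosh θ)⁻¹ := by
    intro θ
    have hc1 : 1 ≤ Real.cosh θ + c := by linarith [Real.one_le_cosh θ]
    have hs : |Real.sinh θ| ≤ Real.cosh θ := by
      rw [Real.abs_sinh]; rw [← Real.cosh_abs]; exact (Real.sinh_lt_cosh _).le
    simp only [hF, abs_mul, abs_inv, abs_pow, abs_of_pos (hD θ)]
    rw [← div_eq_mul_inv, div_le_iff₀ (by positivity), inv_mul_eq_div, le_div_iff₀ (Real.cosh_pos θ)]
    calc |Real.sinh θ| * Real.cosh θ ≤ Real.cosh θ * Real.cosh θ :=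
          mul_le_mul_of_nonneg_right hs (Real.cosh_pos θ).le
      _ ≤ (Real.cosh θ + c) * (Real.cosh θ + c) := by
          apply mul_le_mul <;> nlinarith [Real.cosh_pos θ]
      _ = (Real.cosh θ + c) ^ 2 := by ring
      _ ≤ (Real.cosh θ + c) ^ 5 := pow_le_pow_right₀ hc1 (by norm_num)
  have htop : Tendsto F atTop (𝓝 0) :=
    squeeze_zero_norm (fun θ => by simpa [Real.norm_eq_abs] using hbound θ) tendsto_inv_cosh_atTop
  have hbot : Tendsto F atBot (𝓝 0) :=
    squeeze_zero_norm (fun θ => by simpa [Real.norm_eq_abs] using hbound θ) tendsto_inv_cosh_atBot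
  have key := integral_of_hasDerivAt_of_tendsto hderiv hFint hbot htop
  simp only [sub_zero] at key
  -- expand `∫ F'`
  have i4 := integrable_inv_pow_cosh_add hc (n := 4) (by norm_num)
  have i5 := integrable_inv_pow_cosh_add hc (n := 5) (by norm_num)
  have i6 := integrable_inv_pow_cosh_add hc (n := 6) (by norm_num)
  have h12 : Integrable fun θ => -4 * ((Real.cosh θ + c) ^ 4)⁻¹ + 9 * c * ((Real.cosh θ + c) ^ 5)⁻¹ :=
    (i4.const_mul _).add (i5.const_mul _)
  have h3 : Integrable fun θ => 5 * (c ^ 2 - 1) * ((Real.cosh θ + c) ^ 6)⁻¹ := i6.const_mul _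
  have hsplit : ∫ θ, F' θ = -4 * Yc 4 c + 9 * c * Yc 5 c - 5 * (c ^ 2 - 1) * Yc 6 c := by
    simp only [hF', Yc]
    rw [integral_sub h12 h3, integral_add (i4.const_mul _) (i5.const_mul _), integral_const_mul,
      integral_const_mul, integral_const_mul]
  linarith [hsplit.symm.trans key]


/-- `Y_{n+1} ≤ (cosh-free bound) Y_n / (lower bound of the denominator)`: precisely
`Yc (n+1) c ≤ c⁻¹ · Yc n c` for `c > 0` (pointwise `(cosh θ + c)⁻¹ ≤ c⁻¹`). [folklore] -/
theorem Yc_succ_le {n : ℕ} (hn : 1 ≤ n) {c : ℝ} (hc : 0 < c) :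
    Yc (n + 1) c ≤ c⁻¹ * Yc n c := by
  simp only [Yc]
  rw [← integral_const_mul]
  refine integral_mono (integrable_inv_pow_cosh_add hc.le (by omega))
    ((integrable_inv_pow_cosh_add hc.le hn).const_mul _) fun θ => ?_
  have hD : 0 < Real.cosh θ + c := cosh_add_pos θ hc.le
  have hcD : c ≤ Real.cosh θ + c := by linarith [Real.one_le_cosh θ]
  dsimp only
  rw [pow_succ, mul_inv, mul_comm]
  exact mul_le_mul_of_nonneg_right (inv_anti₀ hc hcD) (inv_nonneg.2 (pow_nonneg hD.le _))

/-! ### Differentiation in the parameter -/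

/-- **Differentiation under the integral sign**: `d/dc Yc n c = −n · Yc (n+1) c` for `c > 0`,
`n ≥ 1` (dominated by `n · 2/(1+θ²)` on `c > c₀/2`). [folklore] -/
theorem hasDerivAt_Yc {n : ℕ} (hn : 1 ≤ n) {c₀ : ℝ} (hc₀ : 0 < c₀) :
    HasDerivAt (fun c => Yc n c) (-n * Yc (n + 1) c₀) c₀ := by
  have hs : Ioi (c₀ / 2) ∈ 𝓝 c₀ := Ioi_mem_nhds (by linarith)
  have hc2 : 0 ≤ c₀ / 2 := by linarith
  have key := hasDerivAt_integral_of_dominated_loc_of_deriv_le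
    (μ := volume) (x₀ := c₀) (s := Ioi (c₀ / 2))
    (F := fun c θ => ((Real.cosh θ + c) ^ n)⁻¹)
    (F' := fun c θ => -n * ((Real.cosh θ + c) ^ (n + 1))⁻¹)
    (bound := fun θ => n * (2 * (1 + θ ^ 2)⁻¹)) hs ?_ ?_ ?_ ?_ ?_ ?_
  · have h2 := key.2
    simp only [integral_const_mul] at h2
    exact h2
  · filter_upwards [hs] with c hc
    exact (continuous_inv_pow_cosh_add (hc2.trans (le_of_lt hc)) n).aestronglyMeasurable
  · exact integrable_inv_pow_cosh_add hc₀.le hn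
  · exact ((continuous_inv_pow_cosh_add hc₀.le (n + 1)).const_mul _).aestronglyMeasurable
  · refine Eventually.of_forall fun θ c hc => ?_
    have hc' : 0 ≤ c := hc2.trans (le_of_lt hc)
    have hnn : 0 ≤ ((Real.cosh θ + c) ^ (n + 1))⁻¹ :=
      inv_nonneg.2 (pow_nonneg (cosh_add_pos θ hc').le _)
    rw [norm_mul, norm_neg, Real.norm_natCast, Real.norm_eq_abs, abs_of_nonneg hnn]
    exact mul_le_mul_of_nonneg_left (inv_pow_cosh_add_le θ hc' (by omega)) (Nat.cast_nonneg n)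
  · exact (integrable_inv_one_add_sq.const_mul 2).const_mul _
  · refine Eventually.of_forall fun θ c hc => ?_
    have hD : 0 < Real.cosh θ + c := cosh_add_pos θ (hc2.trans hc.le)
    obtain ⟨k, rfl⟩ : ∃ k, n = k + 1 := ⟨n - 1, by omega⟩
    have h1 : HasDerivAt (fun c => (Real.cosh θ + c) ^ (k + 1))
        ((k + 1 : ℕ) * (Real.cosh θ + c) ^ k * 1) c := by
      simpa using ((hasDerivAt_id c).const_add (Real.cosh θ)).fun_pow (k + 1)
    have h2 := h1.fun_inv (pow_ne_zero _ hD.ne')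
    refine h2.congr_deriv ?_
    have hD0 : Real.cosh θ + c ≠ 0 := hD.ne'
    push_cast
    field_simp
    ring

/-- The kernel in the variable `γ`: `Y n γ = Yc n (cosh γ) = ∫ dθ/(cosh θ + cosh γ)ⁿ`.
[cite: LovasAndai2017, Theorem 2 (proof), our reorganisation] -/
def Y (n : ℕ) (γ : ℝ) : ℝ := Yc n (Real.cosh γ)

/-- `Y n γ ≥ 0`. [folklore] -/
theorem Y_nonneg (n : ℕ) (γ : ℝ) : 0 ≤ Y n γ := Yc_nonneg n (Real.cosh_pos γ).le

/-- `Y n γ ≤ Y n 0` (`n ≥ 1`). [folklore] -/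
theorem Y_le_Y_zero {n : ℕ} (hn : 1 ≤ n) (γ : ℝ) : Y n γ ≤ Y n 0 := by
  simp only [Y, Real.cosh_zero]
  exact Yc_anti hn zero_le_one (Real.one_le_cosh γ)

/-- `Y (n+1) γ ≤ (cosh γ)⁻¹ Y n γ` (`n ≥ 1`). [folklore] -/
theorem Y_succ_le {n : ℕ} (hn : 1 ≤ n) (γ : ℝ) : Y (n + 1) γ ≤ (Real.cosh γ)⁻¹ * Y n γ :=
  Yc_succ_le hn (Real.cosh_pos γ)

/-- `sinh γ · Y (n+1) γ ≤ Y n 0` for `γ ≥ 0`, `n ≥ 1`. [folklore] -/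
theorem sinh_mul_Y_succ_le {n : ℕ} (hn : 1 ≤ n) {γ : ℝ} (hγ : 0 ≤ γ) :
    Real.sinh γ * Y (n + 1) γ ≤ Y n 0 := by
  have h1 := Y_succ_le hn γ
  have h2 := Y_le_Y_zero hn γ
  have hs : 0 ≤ Real.sinh γ := Real.sinh_nonneg_iff.2 hγ
  have hsc : Real.sinh γ * (Real.cosh γ)⁻¹ ≤ 1 := by
    rw [← div_eq_mul_inv, div_le_one (Real.cosh_pos γ)]
    exact (Real.sinh_lt_cosh γ).le
  calc Real.sinh γ * Y (n + 1) γ ≤ Real.sinh γ * ((Real.cosh γ)⁻¹ * Y n γ) :=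
        mul_le_mul_of_nonneg_left h1 hs
    _ = (Real.sinh γ * (Real.cosh γ)⁻¹) * Y n γ := by ring
    _ ≤ 1 * Y n γ := mul_le_mul_of_nonneg_right hsc (Y_nonneg n γ)
    _ ≤ Y n 0 := by rw [one_mul]; exact h2

/-- `d/dγ Y n γ = −n sinh γ · Y (n+1) γ`. [folklore] -/
theorem hasDerivAt_Y {n : ℕ} (hn : 1 ≤ n) (γ : ℝ) :
    HasDerivAt (Y n) (-n * Real.sinh γ * Y (n + 1) γ) γ := by
  have h : HasDerivAt (fun γ => Yc n (Real.cosh γ)) (-n * Yc (n + 1) (Real.cosh γ) * Real.sinh γ) γ :=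
    (hasDerivAt_Yc hn (Real.cosh_pos γ)).comp γ (Real.hasDerivAt_cosh γ)
  refine (h.congr_deriv ?_)
  simp only [Y]
  ring

/-- `Y n` is continuous (`n ≥ 1`). [folklore] -/
theorem continuous_Y {n : ℕ} (hn : 1 ≤ n) : Continuous (Y n) :=
  continuous_iff_continuousAt.2 fun γ => (hasDerivAt_Y hn γ).continuousAt

/-- `Y 4 γ → 0` as `γ → ∞`. [folklore] -/
theorem tendsto_Y_atTop {n : ℕ} (hn : 1 ≤ n) : Tendsto (Y (n + 1)) atTop (𝓝 0) := by
  refine squeeze_zero (fun γ => Y_nonneg _ γ) (fun γ => (Y_succ_le hn γ).trans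
    (mul_le_mul_of_nonneg_left (Y_le_Y_zero hn γ) (inv_nonneg.2 (Real.cosh_pos γ).le))) ?_
  simpa using tendsto_inv_cosh_atTop.mul_const (Y n 0)

/-- The three-term relation in the variable `γ`: `4 Y₄ − 9 cosh γ · Y₅ + 5 sinh²γ · Y₆ = 0`.
[cite: LovasAndai2017, Theorem 2 (proof), our reorganisation] -/
theorem Y_three_term (γ : ℝ) :
    5 * Real.sinh γ ^ 2 * Y 6 γ = 9 * Real.cosh γ * Y 5 γ - 4 * Y 4 γ := by
  have h := Yc_three_term (Real.cosh_pos γ).le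
  simp only [Y]
  rw [Real.sinh_sq]
  linarith

/-! ### The Laplace-transform certificate and the recursion -/

/-- The certificate `P̄_m(γ)` whose derivative is `((m+4)² e^{−mγ} − (m−2)² e^{−(m+2)γ}) Y₄(γ)`.
[cite: LovasAndai2017, Theorem 2 (proof), our reorganisation] -/
def Pbar (m γ : ℝ) : ℝ :=
  Real.exp (-(m * γ)) * Y 4 γ * ((m - 6) * Real.exp (-(2 * γ)) - (m + 8)) +
    4 * Real.exp (-(m * γ)) * (1 - Real.exp (-(2 * γ))) * (Real.sinh γ * Y 5 γ)

/-- `d/dγ (sinh γ · Y₅ γ) = 4 Y₄ γ − 8 cosh γ · Y₅ γ` (by the three-term relation). [folklore] -/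
theorem hasDerivAt_sinh_mul_Y5 (γ : ℝ) :
    HasDerivAt (fun γ => Real.sinh γ * Y 5 γ) (4 * Y 4 γ - 8 * Real.cosh γ * Y 5 γ) γ := by
  have h := (Real.hasDerivAt_sinh γ).fun_mul (hasDerivAt_Y (n := 5) (by norm_num) γ)
  refine h.congr_deriv ?_
  have hrel := Y_three_term γ
  push_cast
  linear_combination (-1 : ℝ) * hrel

/-- **The certificate identity**: `P̄_m' = ((m+4)² e^{−mγ} − (m−2)² e^{−(m+2)γ}) · Y₄`.
[cite: LovasAndai2017, Theorem 2 (proof), our reorganisation] -/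
theorem hasDerivAt_Pbar (m γ : ℝ) :
    HasDerivAt (Pbar m) (((m + 4) ^ 2 * Real.exp (-(m * γ)) -
      (m - 2) ^ 2 * Real.exp (-((m + 2) * γ))) * Y 4 γ) γ := by
  have hE : HasDerivAt (fun γ => Real.exp (-(m * γ))) (Real.exp (-(m * γ)) * (-m)) γ := by
    have : HasDerivAt (fun γ => -(m * γ)) (-m) γ := by
      simpa [neg_mul] using (hasDerivAt_id γ).const_mul (-m)
    simpa using this.exp
  have hE2 : HasDerivAt (fun γ => Real.exp (-(2 * γ))) (Real.exp (-(2 * γ)) * (-2)) γ := by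
    have : HasDerivAt (fun γ => -(2 * γ)) (-2) γ := by
      simpa [neg_mul] using (hasDerivAt_id γ).const_mul (-2 : ℝ)
    simpa using this.exp
  have hY4 := hasDerivAt_Y (n := 4) (by norm_num) γ
  have hlin : HasDerivAt (fun γ => (m - 6) * Real.exp (-(2 * γ)) - (m + 8))
      ((m - 6) * (Real.exp (-(2 * γ)) * (-2))) γ := by
    simpa using (hE2.const_mul (m - 6)).sub_const (m + 8)
  have hone : HasDerivAt (fun γ => 1 - Real.exp (-(2 * γ))) (-(Real.exp (-(2 * γ)) * (-2))) γ := by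
    simpa using hE2.const_sub 1
  have hS := hasDerivAt_sinh_mul_Y5 γ
  have hP : HasDerivAt (Pbar m) _ γ :=
    ((hE.fun_mul hY4).fun_mul hlin).fun_add (((hE.const_mul 4).fun_mul hone).fun_mul hS)
  refine hP.congr_deriv ?_
  -- algebra in `u = e^γ`
  set E := Real.exp (-(m * γ)) with hEdef
  have hE' : Real.exp (-((m + 2) * γ)) = E * Real.exp (-(2 * γ)) := by
    rw [hEdef, ← Real.exp_add]; ring_nf
  rw [hE']
  set u := Real.exp γ with hu_def
  have hu0 : u ≠ 0 := (Real.exp_pos γ).ne'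
  have hcosh : Real.cosh γ = (u ^ 2 + 1) / (2 * u) := by
    rw [Real.cosh_eq, Real.exp_neg, ← hu_def]; field_simp
  have hsinh : Real.sinh γ = (u ^ 2 - 1) / (2 * u) := by
    rw [Real.sinh_eq, Real.exp_neg, ← hu_def]; field_simp
  have hE2' : Real.exp (-(2 * γ)) = 1 / u ^ 2 := by
    rw [show -(2 * γ) = -γ + -γ by ring, Real.exp_add, Real.exp_neg, ← hu_def]
    field_simp
  push_cast
  rw [hcosh, hsinh, hE2']
  field_simp
  ring

/-- `P̄_m(0) = −14 Y₄(0)`. [folklore] -/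
theorem Pbar_zero (m : ℝ) : Pbar m 0 = -14 * Y 4 0 := by
  simp [Pbar]
  ring

/-- Integrability of `e^{−mγ} Y_n(γ)` on `(0, ∞)` for `m ≥ 1`, `n ≥ 1`. [folklore] -/
theorem integrableOn_exp_mul_Y {n : ℕ} (hn : 1 ≤ n) {m : ℝ} (hm : 1 ≤ m) :
    IntegrableOn (fun γ => Real.exp (-(m * γ)) * Y n γ) (Ioi 0) := by
  have hcont : Continuous fun γ => Real.exp (-(m * γ)) * Y n γ :=
    (Real.continuous_exp.comp (continuous_const.mul continuous_id).neg).mul (continuous_Y hn)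
  refine Integrable.mono' ((exp_neg_integrableOn_Ioi 0 one_pos).const_mul (Y n 0))
    hcont.aestronglyMeasurable ?_
  refine (ae_restrict_iff' measurableSet_Ioi).2 (Eventually.of_forall fun γ hγ => ?_)
  have hγ' : 0 < γ := hγ
  rw [norm_mul, Real.norm_eq_abs, Real.norm_eq_abs, abs_of_pos (Real.exp_pos _),
    abs_of_nonneg (Y_nonneg n γ)]
  have h1 : Real.exp (-(m * γ)) ≤ Real.exp (-1 * γ) := Real.exp_le_exp.2 (by nlinarith)
  calc Real.exp (-(m * γ)) * Y n γ ≤ Real.exp (-1 * γ) * Y n 0 :=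
        mul_le_mul h1 (Y_le_Y_zero hn γ) (Y_nonneg n γ) (Real.exp_pos _).le
    _ = Y n 0 * Real.exp (-1 * γ) := mul_comm _ _

/-- `e^{−mγ} → 0` as `γ → ∞` for `m > 0`. [folklore] -/
theorem tendsto_exp_neg_mul_atTop {m : ℝ} (hm : 0 < m) :
    Tendsto (fun γ : ℝ => Real.exp (-(m * γ))) atTop (𝓝 0) :=
  Real.tendsto_exp_atBot.comp (tendsto_neg_atTop_atBot.comp (tendsto_id.const_mul_atTop hm))

/-- `P̄_m(γ) → 0` as `γ → ∞` (`m ≥ 1`). [folklore] -/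
theorem tendsto_Pbar_atTop {m : ℝ} (hm : 1 ≤ m) : Tendsto (Pbar m) atTop (𝓝 0) := by
  set C : ℝ := Y 4 0 * (|m - 6| + |m + 8|) + 4 * Y 4 0 with hC
  have hbound : ∀ γ, 0 ≤ γ → |Pbar m γ| ≤ Real.exp (-(m * γ)) * C := by
    intro γ hγ
    have hE : 0 < Real.exp (-(m * γ)) := Real.exp_pos _
    have hE2 : 0 < Real.exp (-(2 * γ)) := Real.exp_pos _
    have hE2' : Real.exp (-(2 * γ)) ≤ 1 := by
      rw [Real.exp_le_one_iff]; linarith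
    have hY4 : Y 4 γ ≤ Y 4 0 := Y_le_Y_zero (by norm_num) γ
    have hY40 : 0 ≤ Y 4 γ := Y_nonneg 4 γ
    have hS : Real.sinh γ * Y 5 γ ≤ Y 4 0 := sinh_mul_Y_succ_le (n := 4) (by norm_num) hγ
    have hS0 : 0 ≤ Real.sinh γ * Y 5 γ :=
      mul_nonneg (Real.sinh_nonneg_iff.2 hγ) (Y_nonneg 5 γ)
    have h1 : |Real.exp (-(m * γ)) * Y 4 γ * ((m - 6) * Real.exp (-(2 * γ)) - (m + 8))| ≤
        Real.exp (-(m * γ)) * (Y 4 0 * (|m - 6| + |m + 8|)) := by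
      rw [abs_mul, abs_mul, abs_of_pos hE, abs_of_nonneg hY40, mul_assoc]
      refine mul_le_mul_of_nonneg_left ?_ hE.le
      refine mul_le_mul hY4 ?_ (abs_nonneg _) (Y_nonneg 4 0)
      calc |(m - 6) * Real.exp (-(2 * γ)) - (m + 8)|
          ≤ |(m - 6) * Real.exp (-(2 * γ))| + |m + 8| := abs_sub _ _
        _ = |m - 6| * Real.exp (-(2 * γ)) + |m + 8| := by rw [abs_mul, abs_of_pos hE2]
        _ ≤ |m - 6| * 1 + |m + 8| := by gcongr
        _ = |m - 6| + |m + 8| := by ring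
    have h2 : |4 * Real.exp (-(m * γ)) * (1 - Real.exp (-(2 * γ))) * (Real.sinh γ * Y 5 γ)| ≤
        Real.exp (-(m * γ)) * (4 * Y 4 0) := by
      rw [abs_of_nonneg (by positivity)]
      have : (1 - Real.exp (-(2 * γ))) * (Real.sinh γ * Y 5 γ) ≤ 1 * Y 4 0 :=
        mul_le_mul (by linarith) hS hS0 zero_le_one
      nlinarith
    calc |Pbar m γ| ≤ _ + _ := abs_add_le _ _
      _ ≤ Real.exp (-(m * γ)) * (Y 4 0 * (|m - 6| + |m + 8|)) + Real.exp (-(m * γ)) * (4 * Y 4 0) :=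
          add_le_add h1 h2
      _ = Real.exp (-(m * γ)) * C := by rw [hC]; ring
  have hlim : Tendsto (fun γ => Real.exp (-(m * γ)) * C) atTop (𝓝 0) := by
    simpa using (tendsto_exp_neg_mul_atTop (show 0 < m by linarith)).mul_const C
  refine squeeze_zero_norm' ?_ hlim
  filter_upwards [eventually_ge_atTop 0] with γ hγ
  simpa [Real.norm_eq_abs] using hbound γ hγ

/-- The Laplace transform `L m = ∫₀^∞ e^{−mγ} Y₄(γ) dγ`.
[cite: LovasAndai2017, Theorem 2 (proof), our reorganisation] -/
def L (m : ℝ) : ℝ := ∫ γ in Ioi 0, Real.exp (-(m * γ)) * Y 4 γ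

/-- **The Laplace recursion** `(m+4)² L(m) − (m−2)² L(m+2) = 14 Y₄(0)` for `m ≥ 1`.
[cite: LovasAndai2017, Theorem 2 (proof), our reorganisation] -/
theorem laplace_recursion {m : ℝ} (hm : 1 ≤ m) :
    (m + 4) ^ 2 * L m - (m - 2) ^ 2 * L (m + 2) = 14 * Y 4 0 := by
  have hint1 := integrableOn_exp_mul_Y (n := 4) (by norm_num) hm
  have hint2 := integrableOn_exp_mul_Y (n := 4) (by norm_num) (show 1 ≤ m + 2 by linarith)
  have hint : IntegrableOn (fun γ => ((m + 4) ^ 2 * Real.exp (-(m * γ)) -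
      (m - 2) ^ 2 * Real.exp (-((m + 2) * γ))) * Y 4 γ) (Ioi 0) := by
    have h12 : IntegrableOn (fun γ => (m + 4) ^ 2 * (Real.exp (-(m * γ)) * Y 4 γ) -
        (m - 2) ^ 2 * (Real.exp (-((m + 2) * γ)) * Y 4 γ)) (Ioi 0) :=
      (hint1.const_mul ((m + 4) ^ 2)).sub (hint2.const_mul ((m - 2) ^ 2))
    exact IntegrableOn.congr_fun h12 (fun γ _ => by ring) measurableSet_Ioi
  have key := integral_Ioi_of_hasDerivAt_of_tendsto' (fun γ (_ : γ ∈ Ici (0:ℝ)) => hasDerivAt_Pbar m γ)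
    hint (tendsto_Pbar_atTop hm)
  rw [Pbar_zero] at key
  have e : (fun γ => ((m + 4) ^ 2 * Real.exp (-(m * γ)) -
      (m - 2) ^ 2 * Real.exp (-((m + 2) * γ))) * Y 4 γ) = fun γ =>
      (m + 4) ^ 2 * (Real.exp (-(m * γ)) * Y 4 γ) - (m - 2) ^ 2 * (Real.exp (-((m + 2) * γ)) * Y 4 γ) := by
    funext γ; ring
  rw [e, integral_sub (hint1.const_mul _) (hint2.const_mul _), integral_const_mul,
    integral_const_mul] at key
  simp only [L]
  linarith

/-- The density `4 sinh γ · Y₅(γ) = −Y₄'(γ)` of the law of the singular-value ratio (up to the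
constant of `LovasAndaiTheorem2Integral`). [cite: LovasAndai2017, Theorem 2 (proof), our reorganisation] -/
def dens (γ : ℝ) : ℝ := 4 * Real.sinh γ * Y 5 γ

/-- `Y₄' = −dens`. [folklore] -/
theorem hasDerivAt_Y4 (γ : ℝ) : HasDerivAt (Y 4) (-dens γ) γ := by
  have h := hasDerivAt_Y (n := 4) (by norm_num) γ
  refine h.congr_deriv ?_
  simp only [dens]; push_cast; ring

/-- `dens γ ≥ 0` for `γ ≥ 0`. [folklore] -/
theorem dens_nonneg {γ : ℝ} (hγ : 0 ≤ γ) : 0 ≤ dens γ :=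
  mul_nonneg (mul_nonneg (by norm_num) (Real.sinh_nonneg_iff.2 hγ)) (Y_nonneg 5 γ)

/-- `dens` is continuous. [folklore] -/
theorem continuous_dens : Continuous dens :=
  (continuous_const.mul Real.continuous_sinh).mul (continuous_Y (by norm_num))

/-- `dens` is integrable on `(0, ∞)`. [folklore] -/
theorem integrableOn_dens : IntegrableOn dens (Ioi 0) := by
  have hderiv : ∀ γ ∈ Ici (0:ℝ), HasDerivAt (fun γ => -Y 4 γ) (dens γ) γ := fun γ _ => by
    simpa using (hasDerivAt_Y4 γ).fun_neg
  have hlim : Tendsto (fun γ => -Y 4 γ) atTop (𝓝 0) := by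
    simpa using (tendsto_Y_atTop (n := 3) (by norm_num)).neg
  exact integrableOn_Ioi_deriv_of_nonneg' hderiv (fun γ hγ => dens_nonneg (le_of_lt hγ)) hlim

/-- **Total mass** `∫₀^∞ dens = Y₄(0)`. [folklore] -/
theorem integral_dens : ∫ γ in Ioi 0, dens γ = Y 4 0 := by
  have hint : IntegrableOn (fun γ => -dens γ) (Ioi 0) := integrableOn_dens.neg
  have key := integral_Ioi_of_hasDerivAt_of_tendsto' (fun γ (_ : γ ∈ Ici (0:ℝ)) => hasDerivAt_Y4 γ)
    hint (tendsto_Y_atTop (n := 3) (by norm_num))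
  rw [integral_neg] at key
  linarith

/-- Integrability of `e^{−mγ} dens γ` on `(0,∞)` (`m ≥ 0`). [folklore] -/
theorem integrableOn_exp_mul_dens {m : ℝ} (hm : 0 ≤ m) :
    IntegrableOn (fun γ => Real.exp (-(m * γ)) * dens γ) (Ioi 0) := by
  refine Integrable.mono' integrableOn_dens
    ((Real.continuous_exp.comp (continuous_const.mul continuous_id).neg).mul
      continuous_dens).aestronglyMeasurable ?_
  refine (ae_restrict_iff' measurableSet_Ioi).2 (Eventually.of_forall fun γ hγ => ?_)
  have hγ' : 0 < γ := hγ
  rw [norm_mul, Real.norm_eq_abs, Real.norm_eq_abs, abs_of_pos (Real.exp_pos _),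
    abs_of_nonneg (dens_nonneg hγ'.le)]
  have h1 : Real.exp (-(m * γ)) ≤ 1 := by rw [Real.exp_le_one_iff]; nlinarith
  calc Real.exp (-(m * γ)) * dens γ ≤ 1 * dens γ := mul_le_mul_of_nonneg_right h1 (dens_nonneg hγ'.le)
    _ = dens γ := one_mul _

/-- **Laplace transform of the density**: `∫₀^∞ e^{−mγ} dens(γ) dγ = Y₄(0) − m L(m)` (`m ≥ 1`).
[folklore] -/
theorem integral_exp_mul_dens {m : ℝ} (hm : 1 ≤ m) :
    ∫ γ in Ioi 0, Real.exp (-(m * γ)) * dens γ = Y 4 0 - m * L m := by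
  have hint1 := integrableOn_exp_mul_Y (n := 4) (by norm_num) hm
  have hint2 := integrableOn_exp_mul_dens (show 0 ≤ m by linarith)
  have hderiv : ∀ γ ∈ Ici (0:ℝ), HasDerivAt (fun γ => Real.exp (-(m * γ)) * Y 4 γ)
      (-m * (Real.exp (-(m * γ)) * Y 4 γ) - Real.exp (-(m * γ)) * dens γ) γ := by
    intro γ _
    have hE : HasDerivAt (fun γ => Real.exp (-(m * γ))) (Real.exp (-(m * γ)) * (-m)) γ := by
      have : HasDerivAt (fun γ => -(m * γ)) (-m) γ := by
        simpa [neg_mul] using (hasDerivAt_id γ).const_mul (-m)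
      simpa using this.exp
    have h := hE.fun_mul (hasDerivAt_Y4 γ)
    exact h.congr_deriv (by ring)
  have hint : IntegrableOn (fun γ => -m * (Real.exp (-(m * γ)) * Y 4 γ) -
      Real.exp (-(m * γ)) * dens γ) (Ioi 0) := (hint1.const_mul (-m)).sub hint2
  have hlim : Tendsto (fun γ => Real.exp (-(m * γ)) * Y 4 γ) atTop (𝓝 0) := by
    have hb : ∀ γ, |Real.exp (-(m * γ)) * Y 4 γ| ≤ Real.exp (-(m * γ)) * Y 4 0 := fun γ => by
      rw [abs_mul, abs_of_pos (Real.exp_pos _), abs_of_nonneg (Y_nonneg 4 γ)]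
      exact mul_le_mul_of_nonneg_left (Y_le_Y_zero (by norm_num) γ) (Real.exp_pos _).le
    refine squeeze_zero_norm (fun γ => by simpa [Real.norm_eq_abs] using hb γ) ?_
    simpa using (tendsto_exp_neg_mul_atTop (show 0 < m by linarith)).mul_const (Y 4 0)
  have key := integral_Ioi_of_hasDerivAt_of_tendsto' hderiv hint hlim
  rw [integral_sub (hint1.const_mul (-m)) hint2, integral_const_mul] at key
  simp only [L] at key ⊢
  simp at key
  linarith

/-- Bounds `0 ≤ L(m) ≤ Y₄(0)/m` (`m ≥ 1`). [folklore] -/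
theorem L_nonneg (m : ℝ) : 0 ≤ L m := by
  simp only [L]
  refine setIntegral_nonneg measurableSet_Ioi fun γ _ => ?_
  exact mul_nonneg (Real.exp_pos _).le (Y_nonneg 4 γ)

/-- `L(m) ≤ Y₄(0)/m` (`m ≥ 1`). [folklore] -/
theorem L_le {m : ℝ} (hm : 1 ≤ m) : L m ≤ Y 4 0 / m := by
  have hm0 : 0 < m := by linarith
  have hint1 := integrableOn_exp_mul_Y (n := 4) (by norm_num) hm
  have hint2 : IntegrableOn (fun γ => Real.exp (-(m * γ)) * Y 4 0) (Ioi 0) := by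
    have h0 : IntegrableOn (fun γ => Real.exp (-m * γ) * Y 4 0) (Ioi 0) :=
      (exp_neg_integrableOn_Ioi 0 hm0).mul_const (Y 4 0)
    exact IntegrableOn.congr_fun h0 (fun γ _ => by rw [neg_mul]) measurableSet_Ioi
  have h1 : L m ≤ ∫ γ in Ioi 0, Real.exp (-(m * γ)) * Y 4 0 := by
    simp only [L]
    refine integral_mono hint1 hint2 fun γ => ?_
    exact mul_le_mul_of_nonneg_left (Y_le_Y_zero (by norm_num) γ) (Real.exp_pos _).le
  have h2 : ∫ γ in Ioi 0, Real.exp (-(m * γ)) * Y 4 0 = Y 4 0 / m := by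
    rw [integral_mul_const]
    have := integral_exp_mul_Ioi (show -m < 0 by linarith) 0
    simp only [neg_mul, mul_zero, Real.exp_zero] at this
    rw [this]
    field_simp
  linarith

/-! ### Summation: odd-square series and the value of `Σ κ_j L(2j+1)` -/

/-- `xo l = 1/(2l − 1)`. [folklore] -/
def xo (l : ℕ) : ℝ := 1 / (2 * (l : ℝ) - 1)

/-- `Dt j = (2j−1)(2j+1)(2j+3)`. [folklore] -/
def Dt (j : ℕ) : ℝ := (2 * (j : ℝ) - 1) * (2 * j + 1) * (2 * j + 3)

/-- `Dq j = (2j−1)(2j+1)(2j+3)(2j+5)`. [folklore] -/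
def Dq (j : ℕ) : ℝ := Dt j * (2 * (j : ℝ) + 5)

/-- `2l − 1 ≠ 0` for a natural number `l` (cast to `ℝ`). [folklore] -/
theorem two_mul_natCast_sub_one_ne_zero (l : ℕ) : (2 * (l : ℝ) - 1) ≠ 0 := by
  exact_mod_cast (show (2 * (l : ℤ) - 1) ≠ 0 by omega)

/-- `Dt j ≠ 0`. [folklore] -/
theorem Dt_ne_zero (j : ℕ) : Dt j ≠ 0 := by
  have h1 := two_mul_natCast_sub_one_ne_zero j
  have h2 : (2 * (j : ℝ) + 1) ≠ 0 := by positivity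
  have h3 : (2 * (j : ℝ) + 3) ≠ 0 := by positivity
  simp only [Dt]
  exact mul_ne_zero (mul_ne_zero h1 h2) h3

/-- `Dq j ≠ 0`. [folklore] -/
theorem Dq_ne_zero (j : ℕ) : Dq j ≠ 0 :=
  mul_ne_zero (Dt_ne_zero j) (by positivity)

/-- `Dt j ≥ 15` for `j ≥ 1`. [folklore] -/
theorem Dt_ge {j : ℕ} (hj : 1 ≤ j) : 15 ≤ Dt j := by
  have hj' : (1 : ℝ) ≤ j := by exact_mod_cast hj
  simp only [Dt]
  have h1 : (1 : ℝ) ≤ 2 * j - 1 := by linarith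
  have h2 : (3 : ℝ) ≤ 2 * j + 1 := by linarith
  have h3 : (5 : ℝ) ≤ 2 * j + 3 := by linarith
  calc (15 : ℝ) = 1 * 3 * 5 := by norm_num
    _ ≤ (2 * j - 1) * (2 * j + 1) * (2 * j + 3) := by
        apply mul_le_mul (mul_le_mul h1 h2 (by norm_num) (by linarith)) h3 (by norm_num)
        exact mul_nonneg (by linarith) (by linarith)

/-- `Σ_{l ≥ 0} 1/(2l+1)² = π²/8` in the form `Σ xo(l+1)² = π²/8`. [folklore] -/
theorem hasSum_xo_sq_succ : HasSum (fun l => xo (l + 1) ^ 2) (Real.pi ^ 2 / 8) := by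
  convert Literature.Analysis.SpecialFunctions.hasSum_one_div_odd_sq using 1
  funext l
  simp only [xo]
  push_cast
  rw [div_pow, one_pow]
  congr 1
  ring

/-- `Σ_{l ≥ 0} xo(l)² = 1 + π²/8`. [folklore] -/
theorem hasSum_xo_sq : HasSum (fun l => xo l ^ 2) (1 + Real.pi ^ 2 / 8) := by
  refine (hasSum_nat_add_iff' 1).1 ?_
  have e : (1 + Real.pi ^ 2 / 8) - ∑ i ∈ Finset.range 1, xo i ^ 2 = Real.pi ^ 2 / 8 := by
    norm_num [Finset.sum_range_one, xo]
  rw [e]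
  exact hasSum_xo_sq_succ

/-- `Σ_{l ≥ 0} xo(l+2)² = π²/8 − 1`. [folklore] -/
theorem hasSum_xo_sq_add_two : HasSum (fun l => xo (l + 2) ^ 2) (Real.pi ^ 2 / 8 - 1) := by
  have h := (hasSum_nat_add_iff' (f := fun l => xo l ^ 2) 2).2 hasSum_xo_sq
  have e : (1 + Real.pi ^ 2 / 8) - ∑ i ∈ Finset.range 2, xo i ^ 2 = Real.pi ^ 2 / 8 - 1 := by
    simp only [Finset.sum_range_succ, Finset.sum_range_zero, xo]
    push_cast
    ring
  rwa [e] at h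

/-- `Σ_{l ≥ 0} xo(l+3)² = π²/8 − 1 − 1/9`. [folklore] -/
theorem hasSum_xo_sq_add_three :
    HasSum (fun l => xo (l + 3) ^ 2) (Real.pi ^ 2 / 8 - 1 - 1 / 9) := by
  have h := (hasSum_nat_add_iff' (f := fun l => xo l ^ 2) 3).2 hasSum_xo_sq
  have e : (1 + Real.pi ^ 2 / 8) - ∑ i ∈ Finset.range 3, xo i ^ 2 =
      Real.pi ^ 2 / 8 - 1 - 1 / 9 := by
    simp only [Finset.sum_range_succ, Finset.sum_range_zero, xo]
    push_cast
    ring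
  rwa [e] at h

/-- `xo (l + k) → 0`. [folklore] -/
theorem tendsto_xo_add (k : ℕ) : Tendsto (fun l => xo (l + k)) atTop (𝓝 0) := by
  have h1 : Tendsto (fun l : ℕ => 2 * ((l : ℝ) + k) - 1) atTop atTop := by
    have : Tendsto (fun l : ℕ => 2 * (l : ℝ) + (2 * k - 1)) atTop atTop :=
      tendsto_atTop_add_const_right _ _ (tendsto_natCast_atTop_atTop.const_mul_atTop two_pos)
    exact this.congr fun l => by ring
  have h2 : Tendsto (fun l : ℕ => (1 : ℝ) / (2 * ((l : ℝ) + k) - 1)) atTop (𝓝 0) :=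
    tendsto_const_nhds.div_atTop h1
  refine h2.congr fun l => ?_
  simp only [xo, Nat.cast_add]

/-- The telescoping generator `g(l) = −43 xo(l) + 26 xo(l+1) − 43 xo(l+2)`. [folklore] -/
def gtel (l : ℕ) : ℝ := -43 * xo l + 26 * xo (l + 1) - 43 * xo (l + 2)

/-- `g(0) = 164/3`. [folklore] -/
theorem gtel_zero : gtel 0 = 164 / 3 := by norm_num [gtel, xo]

/-- `g(l) → 0`. [folklore] -/
theorem tendsto_gtel : Tendsto gtel atTop (𝓝 0) := by
  have h : Tendsto (fun l => -43 * xo (l + 0) + (26 * xo (l + 1) - 43 * xo (l + 2))) atTop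
      (𝓝 (-43 * 0 + (26 * 0 - 43 * 0))) :=
    ((tendsto_xo_add 0).const_mul (-43)).add
      (((tendsto_xo_add 1).const_mul 26).sub ((tendsto_xo_add 2).const_mul 43))
  rw [show (-43 * 0 + (26 * 0 - 43 * 0) : ℝ) = 0 by norm_num] at h
  refine h.congr fun l => ?_
  simp only [gtel, add_zero]; ring

/-- **Partial-fraction decomposition** of `(9 − D_l)/D_l²` into odd squares plus a telescoping
term. [folklore] -/
theorem decomp_nine_sub_Dq (l : ℕ) : (9 - Dq l) / Dq l ^ 2 =
    (1 / 256) * (xo l ^ 2 + 9 * xo (l + 1) ^ 2 + 9 * xo (l + 2) ^ 2 + xo (l + 3) ^ 2)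
      + (1 / 1536) * (gtel l - gtel (l + 1)) := by
  set t : ℝ := 2 * (l : ℝ) - 1 with ht
  have hl0 := (Nat.cast_nonneg l : (0 : ℝ) ≤ l)
  have ht0 : t ≠ 0 := two_mul_natCast_sub_one_ne_zero l
  have ht2 : t + 2 ≠ 0 := by apply ne_of_gt; rw [ht]; linarith
  have ht4 : t + 4 ≠ 0 := by apply ne_of_gt; rw [ht]; linarith
  have ht6 : t + 6 ≠ 0 := by apply ne_of_gt; rw [ht]; linarith
  have e0 : xo l = 1 / t := rfl
  have e1 : xo (l + 1) = 1 / (t + 2) := by simp only [xo, ht]; push_cast; ring_nf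
  have e2 : xo (l + 2) = 1 / (t + 4) := by simp only [xo, ht]; push_cast; ring_nf
  have e3 : xo (l + 3) = 1 / (t + 6) := by simp only [xo, ht]; push_cast; ring_nf
  have eD : Dq l = t * (t + 2) * (t + 4) * (t + 6) := by
    simp only [Dq, Dt, ht]; ring
  have eg0 : gtel l = -43 * (1 / t) + 26 * (1 / (t + 2)) - 43 * (1 / (t + 4)) := by
    simp only [gtel, e0, e1, e2]
  have eg1 : gtel (l + 1) = -43 * (1 / (t + 2)) + 26 * (1 / (t + 4)) - 43 * (1 / (t + 6)) := by
    simp only [gtel, show l + 1 + 1 = l + 2 from rfl, show l + 1 + 2 = l + 3 from rfl, e1, e2, e3]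
  rw [eD, e0, e1, e2, e3, eg0, eg1]
  field_simp
  ring

/-- Bound on the telescoping increments: `|g(l) − g(l+1)| ≤ 396 xo(l)²`. [folklore] -/
theorem abs_gtel_sub_le (l : ℕ) : |gtel l - gtel (l + 1)| ≤ 396 * xo l ^ 2 := by
  rcases Nat.eq_zero_or_pos l with rfl | hl
  · norm_num [gtel, xo]
  · have hl' : (1 : ℝ) ≤ l := by exact_mod_cast hl
    set t : ℝ := 2 * (l : ℝ) - 1 with ht
    have ht1 : 1 ≤ t := by linarith
    have e0 : xo l = 1 / t := rfl
    have e1 : xo (l + 1) = 1 / (t + 2) := by simp only [xo, ht]; push_cast; ring_nf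
    have e2 : xo (l + 2) = 1 / (t + 4) := by simp only [xo, ht]; push_cast; ring_nf
    have e3 : xo (l + 3) = 1 / (t + 6) := by simp only [xo, ht]; push_cast; ring_nf
    have hexpr : gtel l - gtel (l + 1) = -(258 / (t * (t + 6))) + 138 / ((t + 2) * (t + 4)) := by
      simp only [gtel, e0, e1, e2, e3, show l + 1 + 1 = l + 2 from rfl, show l + 1 + 2 = l + 3 from rfl]
      field_simp
      ring
    rw [hexpr, e0]
    have hA : 0 ≤ 258 / (t * (t + 6)) := by positivity
    have hB : 0 ≤ 138 / ((t + 2) * (t + 4)) := by positivity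
    have hA' : 258 / (t * (t + 6)) ≤ 258 / t ^ 2 :=
      div_le_div_of_nonneg_left (by norm_num) (by positivity) (by nlinarith)
    have hB' : 138 / ((t + 2) * (t + 4)) ≤ 138 / t ^ 2 :=
      div_le_div_of_nonneg_left (by norm_num) (by positivity) (by nlinarith)
    calc |-(258 / (t * (t + 6))) + 138 / ((t + 2) * (t + 4))|
        ≤ |-(258 / (t * (t + 6)))| + |138 / ((t + 2) * (t + 4))| := abs_add_le _ _
      _ = 258 / (t * (t + 6)) + 138 / ((t + 2) * (t + 4)) := by
          rw [abs_neg, abs_of_nonneg hA, abs_of_nonneg hB]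
      _ ≤ 258 / t ^ 2 + 138 / t ^ 2 := add_le_add hA' hB'
      _ = 396 * (1 / t) ^ 2 := by field_simp; ring

/-- The telescoping increments are absolutely summable. [folklore] -/
theorem summable_gtel_sub : Summable fun l => gtel l - gtel (l + 1) :=
  Summable.of_norm_bounded (hasSum_xo_sq.summable.mul_left 396) fun l => by
    simpa [Real.norm_eq_abs] using abs_gtel_sub_le l

/-- `Σ_l (g(l) − g(l+1)) = g(0)`. [folklore] -/
theorem hasSum_gtel_sub : HasSum (fun l => gtel l - gtel (l + 1)) (gtel 0) := by
  rw [summable_gtel_sub.hasSum_iff_tendsto_nat]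
  have h : ∀ n, ∑ i ∈ Finset.range n, (gtel i - gtel (i + 1)) = gtel 0 - gtel n := by
    intro n
    induction n with
    | zero => simp
    | succ n ih => rw [Finset.sum_range_succ, ih]; ring
  simp_rw [h]
  simpa using (tendsto_const_nhds (x := gtel 0)).sub tendsto_gtel

/-- **`Σ_{l ≥ 0} (9 − D_l)/D_l² = 5π²/512`**, `D_l = (2l−1)(2l+1)(2l+3)(2l+5)`. [folklore] -/
theorem hasSum_nine_sub_Dq : HasSum (fun l => (9 - Dq l) / Dq l ^ 2) (5 * Real.pi ^ 2 / 512) := by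
  have h := ((((hasSum_xo_sq.add (hasSum_xo_sq_succ.mul_left 9)).add
    (hasSum_xo_sq_add_two.mul_left 9)).add hasSum_xo_sq_add_three).mul_left (1 / 256)).add
    (hasSum_gtel_sub.mul_left (1 / 1536))
  have hf : (fun l => (9 - Dq l) / Dq l ^ 2) = fun l =>
      (1 / 256) * (xo l ^ 2 + 9 * xo (l + 1) ^ 2 + 9 * xo (l + 2) ^ 2 + xo (l + 3) ^ 2)
        + (1 / 1536) * (gtel l - gtel (l + 1)) := funext decomp_nine_sub_Dq
  have hv : (5 * Real.pi ^ 2 / 512 : ℝ) = (1 / 256) * (1 + Real.pi ^ 2 / 8 + 9 * (Real.pi ^ 2 / 8) +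
      9 * (Real.pi ^ 2 / 8 - 1) + (Real.pi ^ 2 / 8 - 1 - 1 / 9)) + (1 / 1536) * gtel 0 := by
    rw [gtel_zero]; ring
  rw [hf, hv]
  exact h

/-- The Abel weights `w j = (D_j − 9)/(8 D_j²)`. [folklore] -/
def wA (j : ℕ) : ℝ := (Dq j - 9) / (8 * Dq j ^ 2)

/-- `Σ_j w_j = −5π²/4096`. [folklore] -/
theorem hasSum_wA : HasSum wA (-(5 * Real.pi ^ 2 / 4096)) := by
  have h := hasSum_nine_sub_Dq.mul_left (-(1 / 8 : ℝ))
  have hf : wA = fun j => -(1 / 8 : ℝ) * ((9 - Dq j) / Dq j ^ 2) := by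
    funext j
    have := Dq_ne_zero j
    simp only [wA]
    field_simp
    ring
  have hv : (-(5 * Real.pi ^ 2 / 4096) : ℝ) = -(1 / 8 : ℝ) * (5 * Real.pi ^ 2 / 512) := by ring
  rw [hf, hv]
  exact h

/-- The weight recursion `(2j+7)² w(j+1) − (2j−1)² w(j) = 1/Dt(j+1)`. [folklore] -/
theorem wA_rec (j : ℕ) :
    (2 * (j : ℝ) + 7) ^ 2 * wA (j + 1) - (2 * j - 1) ^ 2 * wA j = 1 / Dt (j + 1) := by
  have h0 := two_mul_natCast_sub_one_ne_zero j
  have h1 : (2 * ((j : ℝ) + 1) - 1) ≠ 0 := by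
    apply ne_of_gt; have := (Nat.cast_nonneg j : (0 : ℝ) ≤ j); linarith
  have h4 : (2 * (j : ℝ) + 1) ≠ 0 := by positivity
  have h5 : (2 * (j : ℝ) + 3) ≠ 0 := by positivity
  have h6 : (2 * (j : ℝ) + 5) ≠ 0 := by positivity
  have h7 : (2 * ((j : ℝ) + 1) + 1) ≠ 0 := by positivity
  have h8 : (2 * ((j : ℝ) + 1) + 3) ≠ 0 := by positivity
  have h9 : (2 * ((j : ℝ) + 1) + 5) ≠ 0 := by positivity
  simp only [wA, Dq, Dt]
  push_cast
  field_simp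
  ring

/-- `25 w_0 = 1/Dt 0` (start of the weight recursion). [folklore] -/
theorem wA_zero : 25 * wA 0 = 1 / Dt 0 := by norm_num [wA, Dq, Dt]

/-- Crude bound `0 ≤ (2N+5)² w N ≤ 1` for `N ≥ 1`. [folklore] -/
theorem wA_weight_bounds {N : ℕ} (hN : 1 ≤ N) :
    0 ≤ (2 * (N : ℝ) + 5) ^ 2 * wA N ∧ (2 * (N : ℝ) + 5) ^ 2 * wA N ≤ 1 := by
  have hD := Dt_ge hN
  have hN' : (1 : ℝ) ≤ N := by exact_mod_cast hN
  have hDq : Dq N = Dt N * (2 * N + 5) := rfl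
  have hDqpos : 0 < Dq N := by rw [hDq]; positivity
  have h9 : 9 ≤ Dq N := by rw [hDq]; nlinarith
  simp only [wA]
  constructor
  · apply mul_nonneg (sq_nonneg _)
    exact div_nonneg (by linarith) (by positivity)
  · rw [← mul_div_assoc, div_le_one (by positivity)]
    -- (2N+5)² (Dq − 9) ≤ 8 Dq², since Dq = Dt (2N+5) with Dt ≥ 15 ≥ 2N+5? no: use Dq ≥ (2N+5)·15
    have : (2 * (N : ℝ) + 5) ^ 2 ≤ Dq N * 8 := by
      rw [hDq]
      have hA : 2 * (N : ℝ) + 3 ≤ Dt N := by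
        have h1 : (1 : ℝ) ≤ 2 * N - 1 := by linarith
        have h2 : (1 : ℝ) ≤ 2 * N + 1 := by linarith
        have h3 : (0 : ℝ) ≤ 2 * N + 3 := by linarith
        calc 2 * (N : ℝ) + 3 = 1 * 1 * (2 * N + 3) := by ring
          _ ≤ (2 * N - 1) * (2 * N + 1) * (2 * N + 3) := by gcongr
      have h15 : 2 * (N : ℝ) + 5 ≤ 8 * Dt N := by linarith
      nlinarith
    have h2 := mul_le_mul_of_nonneg_right this (by linarith : (0 : ℝ) ≤ Dq N - 9)
    nlinarith

/-- The recursion for `a_j = L(2j+1)`: `(2j+5)² a_j − (2j−1)² a_{j+1} = 14 Y₄(0)`. [folklore] -/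
theorem a_rec (j : ℕ) :
    (2 * (j : ℝ) + 5) ^ 2 * L (2 * j + 1) - (2 * j - 1) ^ 2 * L (2 * (j + 1 : ℕ) + 1) =
      14 * Y 4 0 := by
  have hm : (1 : ℝ) ≤ 2 * j + 1 := by have := (Nat.cast_nonneg j : (0 : ℝ) ≤ j); linarith
  have h := laplace_recursion hm
  push_cast
  have e1 : (2 * (j : ℝ) + 1 + 4) = 2 * j + 5 := by ring
  have e2 : (2 * (j : ℝ) + 1 - 2) = 2 * j - 1 := by ring
  have e3 : (2 * (j : ℝ) + 1 + 2) = 2 * (j + 1) + 1 := by ring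
  rw [e1, e2, e3] at h
  exact h

/-- **Abel summation**: `Σ_{j ≤ N} a_j/Dt_j = 14 Y₄(0) Σ_{j<N} w_j + (2N+5)² w_N a_N`. [folklore] -/
theorem sum_a_div_Dt (N : ℕ) :
    ∑ j ∈ Finset.range (N + 1), L (2 * j + 1) / Dt j =
      14 * Y 4 0 * ∑ j ∈ Finset.range N, wA j + (2 * (N : ℝ) + 5) ^ 2 * wA N * L (2 * N + 1) := by
  induction N with
  | zero =>
    have h := wA_zero
    have hD := Dt_ne_zero 0
    simp only [zero_add, Finset.range_one, Finset.sum_singleton, Nat.cast_zero, mul_zero,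
      Finset.range_zero, Finset.sum_empty]
    rw [div_eq_mul_inv, ← one_div, ← h]
    ring
  | succ N ih =>
    rw [Finset.sum_range_succ, ih, Finset.sum_range_succ]
    have hr := a_rec N
    have hw := wA_rec N
    have hD := Dt_ne_zero (N + 1)
    push_cast at hr hw ⊢
    have : L (2 * ((N : ℝ) + 1) + 1) / Dt (N + 1) =
        ((2 * (N : ℝ) + 7) ^ 2 * wA (N + 1) - (2 * N - 1) ^ 2 * wA N) * L (2 * ((N : ℝ) + 1) + 1) := by
      rw [hw]; field_simp
    rw [this]
    linear_combination (wA N) * hr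

/-- The odd Laplace transforms are bounded: `0 ≤ L(2N+1) ≤ Y₄(0)/(2N+1)`. [folklore] -/
theorem L_odd_le (N : ℕ) : L (2 * N + 1) ≤ Y 4 0 / (2 * N + 1) :=
  L_le (by have := (Nat.cast_nonneg N : (0 : ℝ) ≤ N); linarith)

/-- The boundary term of the Abel summation tends to `0`. [folklore] -/
theorem tendsto_boundary :
    Tendsto (fun N : ℕ => (2 * (N : ℝ) + 5) ^ 2 * wA N * L (2 * N + 1)) atTop (𝓝 0) := by
  have hlim : Tendsto (fun N : ℕ => Y 4 0 / (2 * (N : ℝ) + 1)) atTop (𝓝 0) := by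
    refine (tendsto_const_nhds (x := Y 4 0)).div_atTop ?_
    exact tendsto_atTop_add_const_right _ _ (tendsto_natCast_atTop_atTop.const_mul_atTop two_pos)
  refine squeeze_zero_norm' ?_ hlim
  filter_upwards [eventually_ge_atTop 1] with N hN
  obtain ⟨h0, h1⟩ := wA_weight_bounds hN
  have hL0 : 0 ≤ L (2 * N + 1) := L_nonneg _
  rw [Real.norm_eq_abs, abs_of_nonneg (mul_nonneg h0 hL0)]
  calc (2 * (N : ℝ) + 5) ^ 2 * wA N * L (2 * N + 1) ≤ 1 * L (2 * N + 1) :=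
        mul_le_mul_of_nonneg_right h1 hL0
    _ ≤ Y 4 0 / (2 * N + 1) := by rw [one_mul]; exact L_odd_le N

/-- The coefficients `κ_j = −8/((2j−1)(2j+1)(2j+3))` of the power series of the Lemma-6 integrand.
[cite: LovasAndai2017, Lemma 6] -/
def kap (j : ℕ) : ℝ := -8 / Dt j

/-- `|κ_j| ≤ 8 xo(j)²`. [folklore] -/
theorem abs_kap_le (j : ℕ) : |kap j| ≤ 8 * xo j ^ 2 := by
  rcases Nat.eq_zero_or_pos j with rfl | hj
  · norm_num [kap, Dt, xo]
  · have hj' : (1 : ℝ) ≤ j := by exact_mod_cast hj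
    have ht : 1 ≤ 2 * (j : ℝ) - 1 := by linarith
    have hDt : (2 * (j : ℝ) - 1) ^ 2 ≤ Dt j := by
      simp only [Dt]; nlinarith
    have hDpos : 0 < Dt j := by linarith [Dt_ge hj]
    simp only [kap, xo, abs_div, abs_neg, abs_of_pos hDpos]
    rw [div_pow, one_pow, ← mul_div_assoc, mul_one]
    norm_num
    exact div_le_div_of_nonneg_left (by norm_num) (by positivity) hDt

/-- `Σ |κ_j| < ∞`. [folklore] -/
theorem summable_abs_kap : Summable fun j => |kap j| :=
  Summable.of_nonneg_of_le (fun _ => abs_nonneg _) abs_kap_le (hasSum_xo_sq.summable.mul_left 8)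

/-- `Σ κ_j` converges. [folklore] -/
theorem summable_kap : Summable kap := summable_abs_kap.of_abs

/-- **The value of `Σ_j κ_j L(2j+1)`**: `35 π² Y₄(0)/256`.
[cite: LovasAndai2017, Theorem 2 (proof), our reorganisation] -/
theorem hasSum_kap_mul_L : HasSum (fun j => kap j * L (2 * j + 1)) (35 * Real.pi ^ 2 * Y 4 0 / 256) := by
  have hs : Summable fun j => kap j * L (2 * j + 1) := by
    refine Summable.of_norm_bounded (summable_abs_kap.mul_right (Y 4 0)) fun j => ?_
    rw [Real.norm_eq_abs, abs_mul, abs_of_nonneg (L_nonneg _)]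
    refine mul_le_mul_of_nonneg_left ?_ (abs_nonneg _)
    have h := L_odd_le j
    have h2 : Y 4 0 / (2 * j + 1) ≤ Y 4 0 := by
      apply div_le_self (Y_nonneg 4 0)
      have := (Nat.cast_nonneg j : (0 : ℝ) ≤ j); linarith
    exact h.trans h2
  rw [hs.hasSum_iff_tendsto_nat]
  -- partial sums over `range (N+1)`
  rw [← tendsto_add_atTop_iff_nat 1]
  have e : ∀ N, ∑ j ∈ Finset.range (N + 1), kap j * L (2 * j + 1) =
      -8 * (14 * Y 4 0 * ∑ j ∈ Finset.range N, wA j + (2 * (N : ℝ) + 5) ^ 2 * wA N * L (2 * N + 1)) := by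
    intro N
    rw [← sum_a_div_Dt N, Finset.mul_sum]
    refine Finset.sum_congr rfl fun j _ => ?_
    simp only [kap]; ring
  simp_rw [e]
  have h := ((hasSum_wA.tendsto_sum_nat.const_mul (14 * Y 4 0)).add tendsto_boundary).const_mul (-8)
  convert h using 2
  ring

/-! ### The power series of the Lemma-6 integrand and term-wise integration -/

/-- The integrand of [LovasAndai2017, Lemma 6]:
`k(s) = (s + 1/s − ½(s − 1/s)² log((1+s)/(1−s)))/s`. [cite: LovasAndai2017, Lemma 6] -/
def kfun (s : ℝ) : ℝ := (s + s⁻¹ - (s - s⁻¹) ^ 2 / 2 * Real.log ((1 + s) / (1 - s))) / s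

/-- Its primitive `K(e) = ∫₀^e k` (Lebesgue integral over `(0, e]`), so that Lemma 6 reads
`χ̃₁(e) = (4/π²) K(e)`. [cite: LovasAndai2017, Lemma 6] -/
def Kfun (e : ℝ) : ℝ := ∫ s in Ioc 0 e, kfun s

/-- **Power series of the Lemma-6 integrand**: for `0 < t < 1`,
`k(t) = Σ_{j ≥ 0} κ_j t^{2j}` with `κ_j = −8/((2j−1)(2j+1)(2j+3))` (from
`artanh t = Σ t^{2i+1}/(2i+1)`). [cite: LovasAndai2017, Lemma 6] -/
theorem hasSum_kap_mul_pow {t : ℝ} (ht0 : 0 < t) (ht1 : t < 1) :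
    HasSum (fun j => kap j * t ^ (2 * j)) (kfun t) := by
  have habs : |t| < 1 := by rw [abs_lt]; constructor <;> linarith
  have hL := Real.hasSum_log_sub_log_of_abs_lt_one habs
  set Lg := Real.log (1 + t) - Real.log (1 - t) with hLg
  have ht : t ≠ 0 := ht0.ne'
  -- c i = t^{2i+1}/(2i+1), Σ c = Lg/2
  have hc : HasSum (fun i : ℕ => t ^ (2 * i + 1) / (2 * i + 1)) (Lg / 2) := by
    have h := hL.mul_left (1 / 2)
    have hf : (fun i : ℕ => t ^ (2 * i + 1) / (2 * i + 1)) =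
        fun i : ℕ => 1 / 2 * (2 * (1 / (2 * (i : ℝ) + 1)) * t ^ (2 * i + 1)) := by
      funext i; field_simp
    have hv : Lg / 2 = 1 / 2 * Lg := by ring
    rw [hf, hv]; exact h
  -- P1 : Σ t^{2j}/(2j+1) = Lg/(2t)
  have hP1 : HasSum (fun j : ℕ => t ^ (2 * j) / (2 * j + 1)) (Lg / (2 * t)) := by
    have h := hc.mul_left t⁻¹
    have hf : (fun j : ℕ => t ^ (2 * j) / (2 * j + 1)) =
        fun i : ℕ => t⁻¹ * (t ^ (2 * i + 1) / (2 * i + 1)) := by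
      funext i; field_simp; ring
    have hv : Lg / (2 * t) = t⁻¹ * (Lg / 2) := by field_simp
    rw [hf, hv]; exact h
  -- P2 : Σ t^{2j}/(2j+3) = (Lg/2 − t)/t³
  have hP2 : HasSum (fun j : ℕ => t ^ (2 * j) / (2 * j + 3)) ((Lg / 2 - t) / t ^ 3) := by
    have h := ((hasSum_nat_add_iff' (f := fun i : ℕ => t ^ (2 * i + 1) / (2 * i + 1)) 1).2 hc).mul_left
      (t ^ 3)⁻¹
    have hf : (fun j : ℕ => t ^ (2 * j) / (2 * j + 3)) =
        fun i : ℕ => (t ^ 3)⁻¹ * (t ^ (2 * (i + 1) + 1) / (2 * ((i + 1 : ℕ) : ℝ) + 1)) := by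
      funext i; push_cast; field_simp; ring
    have hv : (Lg / 2 - t) / t ^ 3 =
        (t ^ 3)⁻¹ * (Lg / 2 - ∑ i ∈ Finset.range 1, t ^ (2 * i + 1) / (2 * (i : ℝ) + 1)) := by
      simp; field_simp
    rw [hf, hv]; exact h
  -- P0 : Σ t^{2j}/(2j−1) = −1 + t Lg/2
  have hP0 : HasSum (fun j : ℕ => t ^ (2 * j) / (2 * j - 1)) (-1 + t * (Lg / 2)) := by
    refine (hasSum_nat_add_iff' 1).1 ?_
    have h := hc.mul_left t
    have hf : (fun j : ℕ => t ^ (2 * (j + 1)) / (2 * ((j + 1 : ℕ) : ℝ) - 1)) =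
        fun i : ℕ => t * (t ^ (2 * i + 1) / (2 * i + 1)) := by
      funext i
      have h1 : (2 * ((i : ℝ) + 1) - 1) ≠ 0 := by
        apply ne_of_gt; have := (Nat.cast_nonneg i : (0 : ℝ) ≤ i); linarith
      have h2 : (2 * (i : ℝ) + 1) ≠ 0 := by positivity
      push_cast
      rw [mul_div_assoc', div_eq_div_iff h1 h2]
      ring
    have hv : (-1 + t * (Lg / 2)) - ∑ i ∈ Finset.range 1, t ^ (2 * i) / (2 * (i : ℝ) - 1) =
        t * (Lg / 2) := by
      simp
    rw [hf, hv]; exact h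
  have h := (hP0.neg.add (hP1.mul_left 2)).sub hP2
  have hf : (fun j => kap j * t ^ (2 * j)) = fun j : ℕ =>
      -(t ^ (2 * j) / (2 * j - 1)) + 2 * (t ^ (2 * j) / (2 * j + 1)) - t ^ (2 * j) / (2 * j + 3) := by
    funext j
    have h1 := two_mul_natCast_sub_one_ne_zero j
    have h2 : (2 * (j : ℝ) + 1) ≠ 0 := by positivity
    have h3 : (2 * (j : ℝ) + 3) ≠ 0 := by positivity
    simp only [kap, Dt]
    field_simp
    ring
  have hlog : Real.log ((1 + t) / (1 - t)) = Lg := by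
    rw [hLg, Real.log_div (by linarith) (by linarith)]
  have hv : kfun t = -(-1 + t * (Lg / 2)) + 2 * (Lg / (2 * t)) - (Lg / 2 - t) / t ^ 3 := by
    simp only [kfun, hlog]
    field_simp
    ring
  rw [hf, hv]; exact h

/-- `|κ_j t^{2j}| ≤ |κ_j|` on `[0, 1]`. [folklore] -/
theorem abs_kap_mul_pow_le {t : ℝ} (ht0 : 0 ≤ t) (ht1 : t ≤ 1) (j : ℕ) :
    |kap j * t ^ (2 * j)| ≤ |kap j| := by
  rw [abs_mul, abs_of_nonneg (pow_nonneg ht0 _)]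
  exact mul_le_of_le_one_right (abs_nonneg _) (pow_le_one₀ ht0 ht1)

/-- **Term-wise integration**: `K(e) = Σ_j κ_j e^{2j+1}/(2j+1)` for `0 < e ≤ 1`.
[cite: LovasAndai2017, Lemma 6] -/
theorem hasSum_Kfun {e : ℝ} (he0 : 0 < e) (he1 : e ≤ 1) :
    HasSum (fun j => kap j * e ^ (2 * j + 1) / (2 * j + 1)) (Kfun e) := by
  have hne : ∀ᵐ t ∂(volume : Measure ℝ), t ≠ (1 : ℝ) := by
    rw [ae_iff]; simp
  have key := intervalIntegral.hasSum_integral_of_dominated_convergence (μ := volume) (a := 0) (b := e)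
    (F := fun j t => kap j * t ^ (2 * j)) (f := kfun) (fun j _ => |kap j|)
    (fun j => (continuous_const.mul (continuous_pow _)).aestronglyMeasurable) ?_ ?_ ?_ ?_
  · have hI : ∀ j : ℕ, ∫ t in (0 : ℝ)..e, kap j * t ^ (2 * j) = kap j * e ^ (2 * j + 1) / (2 * j + 1) := by
      intro j
      rw [intervalIntegral.integral_const_mul, integral_pow]
      simp
      ring
    simp_rw [hI] at key
    rw [intervalIntegral.integral_of_le he0.le] at key
    exact key
  · intro j
    filter_upwards with t ht
    rw [Set.uIoc_of_le he0.le] at ht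
    rw [Real.norm_eq_abs]
    exact abs_kap_mul_pow_le ht.1.le (ht.2.trans he1) j
  · exact Eventually.of_forall fun t _ => summable_abs_kap
  · exact intervalIntegrable_const
  · filter_upwards [hne] with t ht1 ht
    rw [Set.uIoc_of_le he0.le] at ht
    exact hasSum_kap_mul_pow ht.1 (lt_of_le_of_ne (ht.2.trans he1) ht1)

/-- In particular `K(1) = Σ_j κ_j/(2j+1)`. [cite: LovasAndai2017, Lemma 6] -/
theorem hasSum_Kfun_one : HasSum (fun j => kap j / (2 * j + 1)) (Kfun 1) := by
  simpa using hasSum_Kfun one_pos le_rfl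

/-! ### Assembly: `∫₀^∞ χ̃₁(e^{−γ}) dens(γ) dγ = (29/64) ∫₀^∞ dens` given `K(1) = π²/4` -/

/-- Lovas–Andai's normalised defect function through Lemma 6: `χ̃₁(e) = (4/π²) K(e)`.
[cite: LovasAndai2017, Lemma 6] -/
def chiTilde (e : ℝ) : ℝ := 4 / Real.pi ^ 2 * Kfun e

/-- **The heart of Theorem 2.** If `K(1) = π²/4` (i.e. `χ̃₁(1) = 1`, which is Lemma 6 at `ε = 1`),
then `∫₀^∞ χ̃₁(e^{−γ}) · dens(γ) dγ = (29/64) · ∫₀^∞ dens(γ) dγ`.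
[cite: LovasAndai2017, Theorem 2 (proof), our reorganisation] -/
theorem integral_chiTilde_mul_dens (hK1 : Kfun 1 = Real.pi ^ 2 / 4) :
    ∫ γ in Ioi 0, chiTilde (Real.exp (-γ)) * dens γ = 29 / 64 * ∫ γ in Ioi 0, dens γ := by
  set C : ℝ := 4 / Real.pi ^ 2 with hCdef
  have hpi : Real.pi ^ 2 ≠ 0 := by positivity
  -- dominated convergence for the series in `j`, over `γ ∈ (0, ∞)`
  have key := hasSum_integral_of_dominated_convergence (μ := volume.restrict (Ioi (0 : ℝ)))
    (F := fun j γ => C * (kap j / (2 * j + 1) * Real.exp (-((2 * j + 1) * γ))) * dens γ)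
    (f := fun γ => chiTilde (Real.exp (-γ)) * dens γ) (fun j γ => C * |kap j| * dens γ)
    ?_ ?_ ?_ ?_ ?_
  · -- identify both sides
    have hI : ∀ j : ℕ, ∫ γ in Ioi 0, C * (kap j / (2 * j + 1) * Real.exp (-((2 * j + 1) * γ))) * dens γ
        = C * (Y 4 0 * (kap j / (2 * j + 1)) - kap j * L (2 * j + 1)) := by
      intro j
      have hm : (1 : ℝ) ≤ 2 * j + 1 := by have := (Nat.cast_nonneg j : (0 : ℝ) ≤ j); linarith
      have h := integral_exp_mul_dens hm
      have h2 : (2 * (j : ℝ) + 1) ≠ 0 := by positivity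
      calc ∫ γ in Ioi 0, C * (kap j / (2 * j + 1) * Real.exp (-((2 * j + 1) * γ))) * dens γ
          = C * (kap j / (2 * j + 1)) * ∫ γ in Ioi 0, Real.exp (-((2 * j + 1) * γ)) * dens γ := by
            rw [← integral_const_mul]
            congr 1; funext γ; ring
        _ = C * (Y 4 0 * (kap j / (2 * j + 1)) - kap j * L (2 * j + 1)) := by
            rw [h]; field_simp
    simp_rw [hI] at key
    have h2 : HasSum (fun j : ℕ => C * (Y 4 0 * (kap j / (2 * j + 1)) - kap j * L (2 * j + 1)))
        (C * (Y 4 0 * Kfun 1 - 35 * Real.pi ^ 2 * Y 4 0 / 256)) :=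
      ((hasSum_Kfun_one.mul_left (Y 4 0)).sub hasSum_kap_mul_L).mul_left C
    have huniq := key.unique h2
    rw [huniq, integral_dens, hK1, hCdef]
    field_simp
    ring
  · intro j
    exact (Continuous.aestronglyMeasurable (by
      exact (continuous_const.mul ((continuous_const).mul
        (Real.continuous_exp.comp (continuous_const.mul continuous_id).neg))).mul continuous_dens))
  · intro j
    refine (ae_restrict_iff' measurableSet_Ioi).2 (Eventually.of_forall fun γ hγ => ?_)
    have hγ' : 0 < γ := hγ
    have hd : 0 ≤ dens γ := dens_nonneg hγ'.le
    have hC0 : 0 ≤ C := by rw [hCdef]; positivity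
    rw [norm_mul, norm_mul, Real.norm_eq_abs, Real.norm_eq_abs, Real.norm_eq_abs, abs_of_nonneg hC0,
      abs_of_nonneg hd]
    refine mul_le_mul_of_nonneg_right (mul_le_mul_of_nonneg_left ?_ hC0) hd
    rw [abs_mul, abs_div, abs_of_pos (Real.exp_pos _)]
    have h1 : |kap j| / |2 * (j : ℝ) + 1| ≤ |kap j| := by
      apply div_le_self (abs_nonneg _)
      rw [abs_of_pos (by positivity)]
      have := (Nat.cast_nonneg j : (0 : ℝ) ≤ j); linarith
    have h2 : Real.exp (-((2 * j + 1) * γ)) ≤ 1 := by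
      rw [Real.exp_le_one_iff]
      have := (Nat.cast_nonneg j : (0 : ℝ) ≤ j); nlinarith
    calc |kap j| / |2 * (j : ℝ) + 1| * Real.exp (-((2 * j + 1) * γ)) ≤ |kap j| * 1 :=
          mul_le_mul h1 h2 (Real.exp_pos _).le (abs_nonneg _)
      _ = |kap j| := mul_one _
  · exact Eventually.of_forall fun γ => (summable_abs_kap.mul_left C).mul_right (dens γ)
  · have : (fun γ => ∑' j, C * |kap j| * dens γ) = fun γ => (C * ∑' j, |kap j|) * dens γ := by
      funext γ
      rw [tsum_mul_right, tsum_mul_left]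
    rw [this]
    exact integrableOn_dens.const_mul _
  · refine (ae_restrict_iff' measurableSet_Ioi).2 (Eventually.of_forall fun γ hγ => ?_)
    have hγ' : 0 < γ := hγ
    have he0 : 0 < Real.exp (-γ) := Real.exp_pos _
    have he1 : Real.exp (-γ) ≤ 1 := by rw [Real.exp_le_one_iff]; linarith
    have hK := (hasSum_Kfun he0 he1).mul_left C
    have hK' : HasSum (fun j : ℕ => C * (kap j / (2 * j + 1) * Real.exp (-((2 * j + 1) * γ))))
        (chiTilde (Real.exp (-γ))) := by
      have hf : (fun j : ℕ => C * (kap j / (2 * j + 1) * Real.exp (-((2 * j + 1) * γ)))) =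
          fun j : ℕ => C * (kap j * Real.exp (-γ) ^ (2 * j + 1) / (2 * j + 1)) := by
        funext j
        rw [← Real.exp_nat_mul]
        push_cast
        ring_nf
      rw [hf]
      exact hK
    exact hK'.mul_right (dens γ)

/-! ### Hook-up with Lemma 6 (tree): `K(1) = π²/4`, `χ̃₁ = χ₁/χ₁(1)` -/

/-- **`K(1) = π²/4`**, i.e. `χ̃₁(1) = 1`: [LovasAndai2017, Lemma 6] at `ε = 1`
(`LovasAndai2017_lemma6_holds`) together with `χ₁(1) = 2π²/3 ≠ 0`
(`LovasAndaiLemma6.lovasAndaiChiOne_one`). [cite: LovasAndai2017, Lemma 6 and §5] -/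
theorem Kfun_one : Kfun 1 = Real.pi ^ 2 / 4 := by
  have h := LovasAndai2017_lemma6_holds 1 one_pos le_rfl
  have hne : (lovasAndaiChiOne 1).toReal ≠ 0 := by
    rw [LovasAndaiLemma6.lovasAndaiChiOne_one, ENNReal.toReal_ofReal (by positivity)]
    positivity
  rw [div_self hne] at h
  have hK : Kfun 1 = ∫ s in Set.Ioc (0:ℝ) 1,
      (s + s⁻¹ - (s - s⁻¹) ^ 2 / 2 * Real.log ((1 + s) / (1 - s))) / s := rfl
  rw [← hK] at h
  have hpi : Real.pi ^ 2 ≠ 0 := by positivity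
  field_simp at h
  linarith

/-- `χ̃₁(e) = χ₁(e)/χ₁(1)` for `0 < e ≤ 1` (this is [LovasAndai2017, Lemma 6]).
[cite: LovasAndai2017, Lemma 6] -/
theorem chiTilde_eq_div {e : ℝ} (he0 : 0 < e) (he1 : e ≤ 1) :
    chiTilde e = (lovasAndaiChiOne e).toReal / (lovasAndaiChiOne 1).toReal :=
  (LovasAndai2017_lemma6_holds e he0 he1).symm

/-- **The heart of [LovasAndai2017, Theorem 2], unconditionally**:
`∫₀^∞ χ̃₁(e^{−γ}) · dens(γ) dγ = (29/64) · ∫₀^∞ dens(γ) dγ`, where `dens(γ) dγ` is (up to the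
constant computed in `LovasAndaiTheorem2Integral`) the law of the singular-value ratio
`ε = e^{−γ}` under the eigenvalue weight `μ₁μ₂(½−μ₁)(½−μ₂)(μ₁−μ₂) dμ`.
[cite: LovasAndai2017, Theorem 2 (proof), our reorganisation] -/
theorem integral_chiTilde_mul_dens_eq :
    ∫ γ in Ioi 0, chiTilde (Real.exp (-γ)) * dens γ = 29 / 64 * ∫ γ in Ioi 0, dens γ :=
  integral_chiTilde_mul_dens Kfun_one

/-- `Y₄(0) > 0` (so the total mass `∫₀^∞ dens = Y₄(0)` is positive). [folklore] -/
theorem Y_four_zero_pos : 0 < Y 4 0 := by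
  simp only [Y, Yc, Real.cosh_zero]
  have hpos : ∀ θ, 0 < ((Real.cosh θ + 1) ^ 4)⁻¹ := fun θ =>
    inv_pos.2 (pow_pos (cosh_add_pos θ zero_le_one) 4)
  have hint := integrable_inv_pow_cosh_add (zero_le_one) (n := 4) (by norm_num)
  rw [integral_pos_iff_support_of_nonneg (fun θ => (hpos θ).le) hint]
  have hsupp : Function.support (fun θ : ℝ => ((Real.cosh θ + 1) ^ 4)⁻¹) = Set.univ := by
    ext θ
    simp only [Function.mem_support, ne_eq, Set.mem_univ, iff_true]
    exact (hpos θ).ne'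
  rw [hsupp]
  simp

end Literature.Probability.RandomMatrix.LovasAndai2017

end
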